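import Literature.Analysis.FluidPDE.ForcedFourierPicardCauchy
import Literature.Analysis.FluidPDE.FourierL2PicardLimit
import HarnessLib

/-!
# The limit of the forced Picard scheme: a Fourier-side mild solution WITH force in the rough class

Sixth file of the FORCED twin of the weighted-`L²` Fourier-side construction of the local smooth
solution of the Navier–Stokes system (T. Tao, Anal. PDE 6 (2013) = arXiv:1108.1165, Thm. 5.4 (ii)
= arXiv Thm. 31 (ii), p. 18: existence of the `H¹` mild solution `(u, p, u₀, f, T)` — "`u` obeys
the Duhamel formula (7)", p. 6 — by the contraction of the forced Duhamel map, proof of Thm. 5.1 =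
arXiv Thm. 28, p. 16). Homogeneous twin: `FourierL2PicardLimit`.

Under the forced smallness condition the forced Picard iterates `w_n = picardIterForced c T a b n`
converge at every `(t, ξ)` (geometrically, with every polynomial weight:
`ForcedFourierPicardCauchy`) to the pointwise limit `w = picardLimitForced c T a b`. This file
establishes the properties of the limit consumed by the interface `IsSobolevMildForced`
(`ForcedFourierDuhamelDefs`):

* `w = h + F − D` with `h(t) = heat(clamp t) • a`, `F = forcing c T b` and `D` **jointly
  continuous** (`continuous_hFsub_picardLimitForced`), so that `E = h − w = D − F` is jointly
  measurable, continuous in time at each frequency, with pointwise polynomial decay of every order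
  uniformly in time (`measurable_hsub_picardLimitForced`, `continuous_hsub_picardLimitForced_time`,
  `exists_hasDecay_hsub_picardLimitForced`) — the force coefficients `b` are taken in the WIDE
  class (jointly measurable, continuous in time at each frequency, uniform decay: the class of the
  Leray-projected transform of a Schwartz force, discontinuous at `ξ = 0`);
* the **forced mild (Duhamel) equation** `w = duhamelForced c T a b w`
  (`picardLimitForced_eq_duhamelForced`), the initial value `w(0) = a` (`picardLimitForced_zero`),
  the divergence-free condition (`sum_mul_picardLimitForced`, from divergence-free `a` AND `b`) and
  the conjugation symmetry (`picardLimitForced_conj_symm`), the last two by induction along the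
  iteration in the `L²` class (`sum_mul_duhamel_of_tendsto`/`sum_mul_forcing`,
  `duhamel_conj_symm_of_tendsto`/`forcing_conj_symm`).

No definitions, no named facts.

## Mathlib / tree search

Tree (reused as black boxes): `sum_mul_duhamel_of_tendsto`, `duhamel_conj_symm_of_tendsto`
(`FourierL2PicardLimit`), `exp_weight_enorm_duhamelIntegral_hsub_sub_le'`, `diff_majorant_le`
(`FourierL2PicardDifference`), `memLp_hsub_apply'`, `tendsto_eLpNorm_hsub_apply'`,
`aestronglyMeasurable_hsub_slice'` (`FourierL2PicardClass`); forced inputs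
`exists_geometric_norm_bound_diff_picardIterForced` (`ForcedFourierPicardCauchy`),
`exists_uniform_hasDecay_picardIterForced'` (`ForcedFourierPicardWeighted`),
`class_picardIterForced'` (`ForcedFourierPicardBounds`), `sum_mul_forcing'`, `forcing_conj_symm'`,
`measurable_uncurry_forcing'`, `continuous_forcing_time'` (`ForcedFourierDuhamelForcingMeasurable`).

## References

* T. Tao, Anal. PDE 6 (2013) = arXiv:1108.1165, (7) p. 3, p. 6, Thm. 5.4 (ii) = arXiv Thm. 31
  (p. 18) and the proof of Thm. 5.1 = arXiv Thm. 28 (p. 16). [Tao2011]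
* J. Leray, Acta Math. 63 (1934), §19 (successive approximations). [Leray1934]
-/

noncomputable section

open MeasureTheory Real Set Filter Function intervalIntegral
open scoped ENNReal NNReal ComplexConjugate Convolution
open _root_.Topology

namespace Literature.Analysis.FluidPDE.FourierNS

/-! ### The limit and its class -/

section Limit

variable {c T : ℝ} {a : EuclideanSpace ℝ (Fin 3) → Fin 3 → ℂ}
  {b : ℝ → EuclideanSpace ℝ (Fin 3) → Fin 3 → ℂ}

/-- The pointwise Cauchy property of the forced Picard iterates under the smallness condition.
[cite: Tao2011, Thm. 5.4 (ii) (arXiv Thm. 31); proof of Thm. 5.1 (arXiv Thm. 28, p. 16)] -/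
theorem cauchySeq_picardIterForced (hc : 0 < c) (hT : 0 ≤ T) (ha : AEStronglyMeasurable a volume)
    (haw : ∀ (k : ℕ) j, ∫⁻ η, (ENNReal.ofReal ((1 + ‖η‖) ^ k) * ‖a η j‖ₑ) ^ 2 < ⊤)
    (hbm : Measurable (uncurry b)) (hbt : ∀ ξ, Continuous fun s => b s ξ)
    (hbd : ∀ K : ℕ, ∃ B : ℝ, ∀ s, HasDecay K B (b s))
    {δ₁ δ₂ : ℝ≥0∞} (hδ₁ : δ₁ < ⊤) (hδ₂ : δ₂ < ⊤)
    (hα₁ : ∫⁻ η, (ENNReal.ofReal ‖η‖ * ∑ j, ‖a η j‖ₑ) ^ 2 ≤ δ₁)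
    (hα₂ : ∫⁻ η, (ENNReal.ofReal (‖η‖ ^ 2) * ∑ j, ‖a η j‖ₑ) ^ 2 ≤ δ₂)
    (hF₁ : ∀ t ∈ Icc 0 T, ∫⁻ η, (ENNReal.ofReal ‖η‖ * ∑ j, ‖forcing c T b t η j‖ₑ) ^ 2 ≤ δ₁)
    (hG₁ : ∫⁻ t in Ioc 0 T, ∫⁻ η, (ENNReal.ofReal (‖η‖ ^ 2) *
      ∑ j, ‖forcing c T b t η j‖ₑ) ^ 2 ≤ ENNReal.ofReal c⁻¹ * δ₁)
    (hF₂ : ∀ t ∈ Icc 0 T, ∫⁻ η, (ENNReal.ofReal (‖η‖ ^ 2) * ∑ j, ‖forcing c T b t η j‖ₑ) ^ 2 ≤ δ₂)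
    (hG₂ : ∫⁻ t in Ioc 0 T, ∫⁻ η, (ENNReal.ofReal (‖η‖ ^ 3) *
      ∑ j, ‖forcing c T b t η j‖ₑ) ^ 2 ≤ ENNReal.ofReal c⁻¹ * δ₂)
    (hs : 36864 * (ENNReal.ofReal (4 * π) * (Fintype.card (Fin 3) : ℝ≥0∞) ^ 2) ^ 2 *
        ((SNormLESNormFDerivOfEqConst ℂ (volume : Measure (EuclideanSpace ℝ (Fin 3))) 2 *
          ENNReal.ofReal (2 * π)) ^ (3 / 2 : ℝ)) ^ 2 * ENNReal.ofReal c⁻¹ *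
        (ENNReal.ofReal T * ENNReal.ofReal c⁻¹) ^ (1 / 2 : ℝ) * δ₁ ≤ 1) (t : ℝ) (ξ : EuclideanSpace ℝ (Fin 3)) :
    CauchySeq fun n => picardIterForced c T a b n t ξ := by
  obtain ⟨B, hB⟩ := exists_geometric_norm_bound_diff_picardIterForced hc hT ha haw hbm hbt hbd hδ₁ hδ₂ hα₁ hα₂ hF₁ hG₁ hF₂ hG₂ hs 0
  refine cauchySeq_of_le_geometric (1 / 2) B (by norm_num) fun n => ?_
  rw [dist_eq_norm, ← norm_neg, neg_sub]
  simpa using hB n t ξ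

/-- The forced iterates converge to `picardLimitForced`.
[cite: Tao2011, Thm. 5.4 (ii) (arXiv Thm. 31); proof of Thm. 5.1 (arXiv Thm. 28, p. 16)] -/
theorem tendsto_picardIterForced_picardLimitForced (hc : 0 < c) (hT : 0 ≤ T) (ha : AEStronglyMeasurable a volume)
    (haw : ∀ (k : ℕ) j, ∫⁻ η, (ENNReal.ofReal ((1 + ‖η‖) ^ k) * ‖a η j‖ₑ) ^ 2 < ⊤)
    (hbm : Measurable (uncurry b)) (hbt : ∀ ξ, Continuous fun s => b s ξ)
    (hbd : ∀ K : ℕ, ∃ B : ℝ, ∀ s, HasDecay K B (b s))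
    {δ₁ δ₂ : ℝ≥0∞} (hδ₁ : δ₁ < ⊤) (hδ₂ : δ₂ < ⊤)
    (hα₁ : ∫⁻ η, (ENNReal.ofReal ‖η‖ * ∑ j, ‖a η j‖ₑ) ^ 2 ≤ δ₁)
    (hα₂ : ∫⁻ η, (ENNReal.ofReal (‖η‖ ^ 2) * ∑ j, ‖a η j‖ₑ) ^ 2 ≤ δ₂)
    (hF₁ : ∀ t ∈ Icc 0 T, ∫⁻ η, (ENNReal.ofReal ‖η‖ * ∑ j, ‖forcing c T b t η j‖ₑ) ^ 2 ≤ δ₁)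
    (hG₁ : ∫⁻ t in Ioc 0 T, ∫⁻ η, (ENNReal.ofReal (‖η‖ ^ 2) *
      ∑ j, ‖forcing c T b t η j‖ₑ) ^ 2 ≤ ENNReal.ofReal c⁻¹ * δ₁)
    (hF₂ : ∀ t ∈ Icc 0 T, ∫⁻ η, (ENNReal.ofReal (‖η‖ ^ 2) * ∑ j, ‖forcing c T b t η j‖ₑ) ^ 2 ≤ δ₂)
    (hG₂ : ∫⁻ t in Ioc 0 T, ∫⁻ η, (ENNReal.ofReal (‖η‖ ^ 3) *
      ∑ j, ‖forcing c T b t η j‖ₑ) ^ 2 ≤ ENNReal.ofReal c⁻¹ * δ₂)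
    (hs : 36864 * (ENNReal.ofReal (4 * π) * (Fintype.card (Fin 3) : ℝ≥0∞) ^ 2) ^ 2 *
        ((SNormLESNormFDerivOfEqConst ℂ (volume : Measure (EuclideanSpace ℝ (Fin 3))) 2 *
          ENNReal.ofReal (2 * π)) ^ (3 / 2 : ℝ)) ^ 2 * ENNReal.ofReal c⁻¹ *
        (ENNReal.ofReal T * ENNReal.ofReal c⁻¹) ^ (1 / 2 : ℝ) * δ₁ ≤ 1) (t : ℝ) (ξ : EuclideanSpace ℝ (Fin 3)) :
    Tendsto (fun n => picardIterForced c T a b n t ξ) atTop (𝓝 (picardLimitForced c T a b t ξ)) :=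
  (cauchySeq_picardIterForced hc hT ha haw hbm hbt hbd hδ₁ hδ₂ hα₁ hα₂ hF₁ hG₁ hF₂ hG₂ hs t ξ).tendsto_limUnder

/-- **Weighted rate of convergence of the forced scheme**: for every `K` there is `B` with
`(1+‖ξ‖)^K ‖picardIterForced n t ξ - picardLimitForced t ξ‖ ≤ B (1/2)^n` for all `n, t, ξ`.
[cite: Tao2011, Thm. 5.4 (ii) (arXiv Thm. 31); proof of Thm. 5.1 (arXiv Thm. 28, p. 16)] -/
theorem exists_norm_picardIterForced_sub_picardLimitForced_le (hc : 0 < c) (hT : 0 ≤ T)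
    (ha : AEStronglyMeasurable a volume)
    (haw : ∀ (k : ℕ) j, ∫⁻ η, (ENNReal.ofReal ((1 + ‖η‖) ^ k) * ‖a η j‖ₑ) ^ 2 < ⊤)
    (hbm : Measurable (uncurry b)) (hbt : ∀ ξ, Continuous fun s => b s ξ)
    (hbd : ∀ K : ℕ, ∃ B : ℝ, ∀ s, HasDecay K B (b s))
    {δ₁ δ₂ : ℝ≥0∞} (hδ₁ : δ₁ < ⊤) (hδ₂ : δ₂ < ⊤)
    (hα₁ : ∫⁻ η, (ENNReal.ofReal ‖η‖ * ∑ j, ‖a η j‖ₑ) ^ 2 ≤ δ₁)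
    (hα₂ : ∫⁻ η, (ENNReal.ofReal (‖η‖ ^ 2) * ∑ j, ‖a η j‖ₑ) ^ 2 ≤ δ₂)
    (hF₁ : ∀ t ∈ Icc 0 T, ∫⁻ η, (ENNReal.ofReal ‖η‖ * ∑ j, ‖forcing c T b t η j‖ₑ) ^ 2 ≤ δ₁)
    (hG₁ : ∫⁻ t in Ioc 0 T, ∫⁻ η, (ENNReal.ofReal (‖η‖ ^ 2) *
      ∑ j, ‖forcing c T b t η j‖ₑ) ^ 2 ≤ ENNReal.ofReal c⁻¹ * δ₁)
    (hF₂ : ∀ t ∈ Icc 0 T, ∫⁻ η, (ENNReal.ofReal (‖η‖ ^ 2) * ∑ j, ‖forcing c T b t η j‖ₑ) ^ 2 ≤ δ₂)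
    (hG₂ : ∫⁻ t in Ioc 0 T, ∫⁻ η, (ENNReal.ofReal (‖η‖ ^ 3) *
      ∑ j, ‖forcing c T b t η j‖ₑ) ^ 2 ≤ ENNReal.ofReal c⁻¹ * δ₂)
    (hs : 36864 * (ENNReal.ofReal (4 * π) * (Fintype.card (Fin 3) : ℝ≥0∞) ^ 2) ^ 2 *
        ((SNormLESNormFDerivOfEqConst ℂ (volume : Measure (EuclideanSpace ℝ (Fin 3))) 2 *
          ENNReal.ofReal (2 * π)) ^ (3 / 2 : ℝ)) ^ 2 * ENNReal.ofReal c⁻¹ *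
        (ENNReal.ofReal T * ENNReal.ofReal c⁻¹) ^ (1 / 2 : ℝ) * δ₁ ≤ 1) (K : ℕ) :
    ∃ B : ℝ, ∀ n t ξ, (1 + ‖ξ‖) ^ K * ‖picardIterForced c T a b n t ξ - picardLimitForced c T a b t ξ‖ ≤
      B * (1 / 2) ^ n := by
  obtain ⟨B, hB⟩ := exists_geometric_norm_bound_diff_picardIterForced hc hT ha haw hbm hbt hbd hδ₁ hδ₂ hα₁ hα₂ hF₁ hG₁ hF₂ hG₂ hs K
  refine ⟨2 * B, fun n t ξ => ?_⟩
  have hw : (0 : ℝ) < (1 + ‖ξ‖) ^ K := by positivity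
  have hdist : ∀ m, dist (picardIterForced c T a b m t ξ) (picardIterForced c T a b (m + 1) t ξ) ≤
      B * ((1 + ‖ξ‖) ^ K)⁻¹ * (1 / 2) ^ m := fun m => by
    rw [dist_eq_norm, ← norm_neg, neg_sub, mul_assoc, mul_comm ((1 + ‖ξ‖) ^ K)⁻¹, ← mul_assoc,
      ← div_eq_mul_inv, le_div_iff₀ hw, mul_comm]
    exact hB m t ξ
  have h := dist_le_of_le_geometric_of_tendsto (1 / 2) (B * ((1 + ‖ξ‖) ^ K)⁻¹) (by norm_num) hdist
    (tendsto_picardIterForced_picardLimitForced hc hT ha haw hbm hbt hbd hδ₁ hδ₂ hα₁ hα₂ hF₁ hG₁ hF₂ hG₂ hs t ξ) n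
  rw [dist_eq_norm] at h
  calc (1 + ‖ξ‖) ^ K * ‖picardIterForced c T a b n t ξ - picardLimitForced c T a b t ξ‖
      ≤ (1 + ‖ξ‖) ^ K * (B * ((1 + ‖ξ‖) ^ K)⁻¹ * (1 / 2) ^ n / (1 - 1 / 2)) :=
        mul_le_mul_of_nonneg_left h hw.le
    _ = 2 * B * (1 / 2) ^ n := by field_simp; ring

/-- The limit of the forced scheme only sees the clamped time.
[cite: Tao2011, Thm. 5.4 (ii) (arXiv Thm. 31), Duhamel formula (7)] -/
theorem picardLimitForced_clamp (hT : 0 ≤ T) (t : ℝ) : picardLimitForced c T a b (clamp T t) = picardLimitForced c T a b t := by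
  funext ξ
  simp only [picardLimitForced, picardIterForced_clamp hT]

/-- **Joint continuity of the Duhamel-integral part of the forced limit**
`D = h + F - picardLimitForced` (uniform limit of the jointly continuous `D_n = h + F − w_n`; the
forcing term `F` itself is in general NOT continuous in the frequency at `ξ = 0`).
[cite: Tao2011, Thm. 5.4 (ii) (arXiv Thm. 31); proof of Thm. 5.1 (arXiv Thm. 28, p. 16)] -/
theorem continuous_hFsub_picardLimitForced (hc : 0 < c) (hT : 0 ≤ T) (ha : AEStronglyMeasurable a volume)
    (haw : ∀ (k : ℕ) j, ∫⁻ η, (ENNReal.ofReal ((1 + ‖η‖) ^ k) * ‖a η j‖ₑ) ^ 2 < ⊤)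
    (hbm : Measurable (uncurry b)) (hbt : ∀ ξ, Continuous fun s => b s ξ)
    (hbd : ∀ K : ℕ, ∃ B : ℝ, ∀ s, HasDecay K B (b s))
    {δ₁ δ₂ : ℝ≥0∞} (hδ₁ : δ₁ < ⊤) (hδ₂ : δ₂ < ⊤)
    (hα₁ : ∫⁻ η, (ENNReal.ofReal ‖η‖ * ∑ j, ‖a η j‖ₑ) ^ 2 ≤ δ₁)
    (hα₂ : ∫⁻ η, (ENNReal.ofReal (‖η‖ ^ 2) * ∑ j, ‖a η j‖ₑ) ^ 2 ≤ δ₂)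
    (hF₁ : ∀ t ∈ Icc 0 T, ∫⁻ η, (ENNReal.ofReal ‖η‖ * ∑ j, ‖forcing c T b t η j‖ₑ) ^ 2 ≤ δ₁)
    (hG₁ : ∫⁻ t in Ioc 0 T, ∫⁻ η, (ENNReal.ofReal (‖η‖ ^ 2) *
      ∑ j, ‖forcing c T b t η j‖ₑ) ^ 2 ≤ ENNReal.ofReal c⁻¹ * δ₁)
    (hF₂ : ∀ t ∈ Icc 0 T, ∫⁻ η, (ENNReal.ofReal (‖η‖ ^ 2) * ∑ j, ‖forcing c T b t η j‖ₑ) ^ 2 ≤ δ₂)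
    (hG₂ : ∫⁻ t in Ioc 0 T, ∫⁻ η, (ENNReal.ofReal (‖η‖ ^ 3) *
      ∑ j, ‖forcing c T b t η j‖ₑ) ^ 2 ≤ ENNReal.ofReal c⁻¹ * δ₂)
    (hs : 36864 * (ENNReal.ofReal (4 * π) * (Fintype.card (Fin 3) : ℝ≥0∞) ^ 2) ^ 2 *
        ((SNormLESNormFDerivOfEqConst ℂ (volume : Measure (EuclideanSpace ℝ (Fin 3))) 2 *
          ENNReal.ofReal (2 * π)) ^ (3 / 2 : ℝ)) ^ 2 * ENNReal.ofReal c⁻¹ *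
        (ENNReal.ofReal T * ENNReal.ofReal c⁻¹) ^ (1 / 2 : ℝ) * δ₁ ≤ 1) :
    Continuous (uncurry fun t ξ =>
      heat c ξ (clamp T t) • a ξ + forcing c T b t ξ - picardLimitForced c T a b t ξ) := by
  obtain ⟨B, hB⟩ := exists_norm_picardIterForced_sub_picardLimitForced_le hc hT ha haw hbm hbt hbd hδ₁ hδ₂ hα₁ hα₂ hF₁ hG₁ hF₂ hG₂ hs 0
  have hunif : TendstoUniformly (fun n => uncurry fun t ξ =>
      heat c ξ (clamp T t) • a ξ + forcing c T b t ξ - picardIterForced c T a b n t ξ)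
      (uncurry fun t ξ => heat c ξ (clamp T t) • a ξ + forcing c T b t ξ -
        picardLimitForced c T a b t ξ) atTop := by
    rw [Metric.tendstoUniformly_iff]
    intro ε hε
    obtain ⟨N, hN⟩ : ∃ N : ℕ, |B| * (1 / 2 : ℝ) ^ N < ε := by
      have : Tendsto (fun n : ℕ => |B| * (1 / 2 : ℝ) ^ n) atTop (𝓝 (|B| * 0)) :=
        (tendsto_pow_atTop_nhds_zero_of_lt_one (by norm_num) (by norm_num)).const_mul _
      rw [mul_zero] at this
      exact (this.eventually (gt_mem_nhds hε)).exists
    refine eventually_atTop.2 ⟨N, fun n hn p => ?_⟩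
    have hpow : (1 / 2 : ℝ) ^ n ≤ (1 / 2) ^ N := pow_le_pow_of_le_one (by norm_num) (by norm_num) hn
    have h1 := hB n p.1 p.2
    rw [pow_zero, one_mul] at h1
    rw [dist_eq_norm]
    calc ‖uncurry (fun t ξ => heat c ξ (clamp T t) • a ξ + forcing c T b t ξ -
            picardLimitForced c T a b t ξ) p -
          uncurry (fun t ξ => heat c ξ (clamp T t) • a ξ + forcing c T b t ξ -
            picardIterForced c T a b n t ξ) p‖
        = ‖picardIterForced c T a b n p.1 p.2 - picardLimitForced c T a b p.1 p.2‖ := by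
          simp only [uncurry]; congr 1; abel
      _ ≤ B * (1 / 2) ^ n := h1
      _ ≤ |B| * (1 / 2) ^ n := mul_le_mul_of_nonneg_right (le_abs_self B) (by positivity)
      _ ≤ |B| * (1 / 2) ^ N := mul_le_mul_of_nonneg_left hpow (abs_nonneg B)
      _ < ε := hN
  exact hunif.continuous (Eventually.of_forall fun n =>
    (class_picardIterForced' hc.le hT ha haw hbm hbt hbd n).1).frequently

/-- **Joint measurability of the Duhamel part of the forced limit** `E = h − picardLimitForced`
(`= D − F`, `D` jointly continuous, `F` jointly measurable).
[cite: Tao2011, Thm. 5.4 (ii) (arXiv Thm. 31); proof of Thm. 5.1 (arXiv Thm. 28, p. 16)] -/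
theorem measurable_hsub_picardLimitForced (hc : 0 < c) (hT : 0 ≤ T) (ha : AEStronglyMeasurable a volume)
    (haw : ∀ (k : ℕ) j, ∫⁻ η, (ENNReal.ofReal ((1 + ‖η‖) ^ k) * ‖a η j‖ₑ) ^ 2 < ⊤)
    (hbm : Measurable (uncurry b)) (hbt : ∀ ξ, Continuous fun s => b s ξ)
    (hbd : ∀ K : ℕ, ∃ B : ℝ, ∀ s, HasDecay K B (b s))
    {δ₁ δ₂ : ℝ≥0∞} (hδ₁ : δ₁ < ⊤) (hδ₂ : δ₂ < ⊤)
    (hα₁ : ∫⁻ η, (ENNReal.ofReal ‖η‖ * ∑ j, ‖a η j‖ₑ) ^ 2 ≤ δ₁)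
    (hα₂ : ∫⁻ η, (ENNReal.ofReal (‖η‖ ^ 2) * ∑ j, ‖a η j‖ₑ) ^ 2 ≤ δ₂)
    (hF₁ : ∀ t ∈ Icc 0 T, ∫⁻ η, (ENNReal.ofReal ‖η‖ * ∑ j, ‖forcing c T b t η j‖ₑ) ^ 2 ≤ δ₁)
    (hG₁ : ∫⁻ t in Ioc 0 T, ∫⁻ η, (ENNReal.ofReal (‖η‖ ^ 2) *
      ∑ j, ‖forcing c T b t η j‖ₑ) ^ 2 ≤ ENNReal.ofReal c⁻¹ * δ₁)
    (hF₂ : ∀ t ∈ Icc 0 T, ∫⁻ η, (ENNReal.ofReal (‖η‖ ^ 2) * ∑ j, ‖forcing c T b t η j‖ₑ) ^ 2 ≤ δ₂)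
    (hG₂ : ∫⁻ t in Ioc 0 T, ∫⁻ η, (ENNReal.ofReal (‖η‖ ^ 3) *
      ∑ j, ‖forcing c T b t η j‖ₑ) ^ 2 ≤ ENNReal.ofReal c⁻¹ * δ₂)
    (hs : 36864 * (ENNReal.ofReal (4 * π) * (Fintype.card (Fin 3) : ℝ≥0∞) ^ 2) ^ 2 *
        ((SNormLESNormFDerivOfEqConst ℂ (volume : Measure (EuclideanSpace ℝ (Fin 3))) 2 *
          ENNReal.ofReal (2 * π)) ^ (3 / 2 : ℝ)) ^ 2 * ENNReal.ofReal c⁻¹ *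
        (ENNReal.ofReal T * ENNReal.ofReal c⁻¹) ^ (1 / 2 : ℝ) * δ₁ ≤ 1) :
    Measurable (uncurry fun t ξ => heat c ξ (clamp T t) • a ξ - picardLimitForced c T a b t ξ) := by
  have hD := continuous_hFsub_picardLimitForced hc hT ha haw hbm hbt hbd hδ₁ hδ₂ hα₁ hα₂ hF₁ hG₁ hF₂ hG₂ hs
  have heq : (uncurry fun t ξ => heat c ξ (clamp T t) • a ξ - picardLimitForced c T a b t ξ) =
      fun p => uncurry (fun t ξ => heat c ξ (clamp T t) • a ξ + forcing c T b t ξ -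
        picardLimitForced c T a b t ξ) p - uncurry (forcing c T b) p := by
    funext p; simp only [uncurry]; abel
  rw [heq]
  exact hD.measurable.sub (measurable_uncurry_forcing' hbm)

/-- **Continuity in time, at each frequency, of the Duhamel part of the forced limit**
`E = h − picardLimitForced` (`= D − F`, `D` jointly continuous, `t ↦ F(t, ξ)` continuous).
[cite: Tao2011, Thm. 5.4 (ii) (arXiv Thm. 31); proof of Thm. 5.1 (arXiv Thm. 28, p. 16)] -/
theorem continuous_hsub_picardLimitForced_time (hc : 0 < c) (hT : 0 ≤ T)
    (ha : AEStronglyMeasurable a volume)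
    (haw : ∀ (k : ℕ) j, ∫⁻ η, (ENNReal.ofReal ((1 + ‖η‖) ^ k) * ‖a η j‖ₑ) ^ 2 < ⊤)
    (hbm : Measurable (uncurry b)) (hbt : ∀ ξ, Continuous fun s => b s ξ)
    (hbd : ∀ K : ℕ, ∃ B : ℝ, ∀ s, HasDecay K B (b s))
    {δ₁ δ₂ : ℝ≥0∞} (hδ₁ : δ₁ < ⊤) (hδ₂ : δ₂ < ⊤)
    (hα₁ : ∫⁻ η, (ENNReal.ofReal ‖η‖ * ∑ j, ‖a η j‖ₑ) ^ 2 ≤ δ₁)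
    (hα₂ : ∫⁻ η, (ENNReal.ofReal (‖η‖ ^ 2) * ∑ j, ‖a η j‖ₑ) ^ 2 ≤ δ₂)
    (hF₁ : ∀ t ∈ Icc 0 T, ∫⁻ η, (ENNReal.ofReal ‖η‖ * ∑ j, ‖forcing c T b t η j‖ₑ) ^ 2 ≤ δ₁)
    (hG₁ : ∫⁻ t in Ioc 0 T, ∫⁻ η, (ENNReal.ofReal (‖η‖ ^ 2) *
      ∑ j, ‖forcing c T b t η j‖ₑ) ^ 2 ≤ ENNReal.ofReal c⁻¹ * δ₁)
    (hF₂ : ∀ t ∈ Icc 0 T, ∫⁻ η, (ENNReal.ofReal (‖η‖ ^ 2) * ∑ j, ‖forcing c T b t η j‖ₑ) ^ 2 ≤ δ₂)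
    (hG₂ : ∫⁻ t in Ioc 0 T, ∫⁻ η, (ENNReal.ofReal (‖η‖ ^ 3) *
      ∑ j, ‖forcing c T b t η j‖ₑ) ^ 2 ≤ ENNReal.ofReal c⁻¹ * δ₂)
    (hs : 36864 * (ENNReal.ofReal (4 * π) * (Fintype.card (Fin 3) : ℝ≥0∞) ^ 2) ^ 2 *
        ((SNormLESNormFDerivOfEqConst ℂ (volume : Measure (EuclideanSpace ℝ (Fin 3))) 2 *
          ENNReal.ofReal (2 * π)) ^ (3 / 2 : ℝ)) ^ 2 * ENNReal.ofReal c⁻¹ *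
        (ENNReal.ofReal T * ENNReal.ofReal c⁻¹) ^ (1 / 2 : ℝ) * δ₁ ≤ 1) (η : EuclideanSpace ℝ (Fin 3)) :
    Continuous fun t => heat c η (clamp T t) • a η - picardLimitForced c T a b t η := by
  have hD := continuous_hFsub_picardLimitForced hc hT ha haw hbm hbt hbd hδ₁ hδ₂ hα₁ hα₂ hF₁ hG₁ hF₂ hG₂ hs
  have heq : (fun t => heat c η (clamp T t) • a η - picardLimitForced c T a b t η) =
      fun t => (heat c η (clamp T t) • a η + forcing c T b t η - picardLimitForced c T a b t η) -
        forcing c T b t η := by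
    funext t; abel
  rw [heq]
  exact (hD.uncurry_right η).sub (continuous_forcing_time' hbt η)

/-- **Pointwise polynomial decay of every order of the Duhamel part of the forced limit,
uniformly in time** (the uniform decay of the `E_n` passes to the limit).
[cite: Tao2011, Thm. 5.4 (ii)+(iv) (arXiv Thm. 31)] -/
theorem exists_hasDecay_hsub_picardLimitForced (hc : 0 < c) (hT : 0 ≤ T) (ha : AEStronglyMeasurable a volume)
    (haw : ∀ (k : ℕ) j, ∫⁻ η, (ENNReal.ofReal ((1 + ‖η‖) ^ k) * ‖a η j‖ₑ) ^ 2 < ⊤)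
    (hbm : Measurable (uncurry b)) (hbt : ∀ ξ, Continuous fun s => b s ξ)
    (hbd : ∀ K : ℕ, ∃ B : ℝ, ∀ s, HasDecay K B (b s))
    {δ₁ δ₂ : ℝ≥0∞} (hδ₁ : δ₁ < ⊤) (hδ₂ : δ₂ < ⊤)
    (hα₁ : ∫⁻ η, (ENNReal.ofReal ‖η‖ * ∑ j, ‖a η j‖ₑ) ^ 2 ≤ δ₁)
    (hα₂ : ∫⁻ η, (ENNReal.ofReal (‖η‖ ^ 2) * ∑ j, ‖a η j‖ₑ) ^ 2 ≤ δ₂)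
    (hF₁ : ∀ t ∈ Icc 0 T, ∫⁻ η, (ENNReal.ofReal ‖η‖ * ∑ j, ‖forcing c T b t η j‖ₑ) ^ 2 ≤ δ₁)
    (hG₁ : ∫⁻ t in Ioc 0 T, ∫⁻ η, (ENNReal.ofReal (‖η‖ ^ 2) *
      ∑ j, ‖forcing c T b t η j‖ₑ) ^ 2 ≤ ENNReal.ofReal c⁻¹ * δ₁)
    (hF₂ : ∀ t ∈ Icc 0 T, ∫⁻ η, (ENNReal.ofReal (‖η‖ ^ 2) * ∑ j, ‖forcing c T b t η j‖ₑ) ^ 2 ≤ δ₂)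
    (hG₂ : ∫⁻ t in Ioc 0 T, ∫⁻ η, (ENNReal.ofReal (‖η‖ ^ 3) *
      ∑ j, ‖forcing c T b t η j‖ₑ) ^ 2 ≤ ENNReal.ofReal c⁻¹ * δ₂)
    (hs : 36864 * (ENNReal.ofReal (4 * π) * (Fintype.card (Fin 3) : ℝ≥0∞) ^ 2) ^ 2 *
        ((SNormLESNormFDerivOfEqConst ℂ (volume : Measure (EuclideanSpace ℝ (Fin 3))) 2 *
          ENNReal.ofReal (2 * π)) ^ (3 / 2 : ℝ)) ^ 2 * ENNReal.ofReal c⁻¹ *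
        (ENNReal.ofReal T * ENNReal.ofReal c⁻¹) ^ (1 / 2 : ℝ) * δ₁ ≤ 1) (K : ℕ) :
    ∃ B : ℝ, ∀ t, HasDecay K B (fun ξ => heat c ξ (clamp T t) • a ξ - picardLimitForced c T a b t ξ) := by
  obtain ⟨B, hB⟩ := exists_uniform_hasDecay_picardIterForced' hc hT ha haw hbm hbt hbd hδ₁ hδ₂ hα₁ hα₂ hF₁ hG₁ hF₂ hG₂ hs K
  refine ⟨B, fun t ξ => ?_⟩
  have ht : Tendsto (fun n => heat c ξ (clamp T t) • a ξ - picardIterForced c T a b n t ξ) atTop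
      (𝓝 (heat c ξ (clamp T t) • a ξ - picardLimitForced c T a b t ξ)) :=
    tendsto_const_nhds.sub (tendsto_picardIterForced_picardLimitForced hc hT ha haw hbm hbt hbd hδ₁ hδ₂ hα₁ hα₂ hF₁ hG₁ hF₂ hG₂ hs t ξ)
  exact le_of_tendsto ((continuous_norm.tendsto _).comp ht) (Eventually.of_forall fun n => hB n t ξ)

/-- **The initial value of the forced limit**: `picardLimitForced c T a b 0 = a` (every forced
iterate equals `a` at `t = 0`). [cite: Tao2011, Thm. 5.4 (ii) (arXiv Thm. 31), Duhamel formula (7)] -/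
theorem picardLimitForced_zero (hc : 0 < c) (hT : 0 ≤ T) (ha : AEStronglyMeasurable a volume)
    (haw : ∀ (k : ℕ) j, ∫⁻ η, (ENNReal.ofReal ((1 + ‖η‖) ^ k) * ‖a η j‖ₑ) ^ 2 < ⊤)
    (hbm : Measurable (uncurry b)) (hbt : ∀ ξ, Continuous fun s => b s ξ)
    (hbd : ∀ K : ℕ, ∃ B : ℝ, ∀ s, HasDecay K B (b s))
    {δ₁ δ₂ : ℝ≥0∞} (hδ₁ : δ₁ < ⊤) (hδ₂ : δ₂ < ⊤)
    (hα₁ : ∫⁻ η, (ENNReal.ofReal ‖η‖ * ∑ j, ‖a η j‖ₑ) ^ 2 ≤ δ₁)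
    (hα₂ : ∫⁻ η, (ENNReal.ofReal (‖η‖ ^ 2) * ∑ j, ‖a η j‖ₑ) ^ 2 ≤ δ₂)
    (hF₁ : ∀ t ∈ Icc 0 T, ∫⁻ η, (ENNReal.ofReal ‖η‖ * ∑ j, ‖forcing c T b t η j‖ₑ) ^ 2 ≤ δ₁)
    (hG₁ : ∫⁻ t in Ioc 0 T, ∫⁻ η, (ENNReal.ofReal (‖η‖ ^ 2) *
      ∑ j, ‖forcing c T b t η j‖ₑ) ^ 2 ≤ ENNReal.ofReal c⁻¹ * δ₁)
    (hF₂ : ∀ t ∈ Icc 0 T, ∫⁻ η, (ENNReal.ofReal (‖η‖ ^ 2) * ∑ j, ‖forcing c T b t η j‖ₑ) ^ 2 ≤ δ₂)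
    (hG₂ : ∫⁻ t in Ioc 0 T, ∫⁻ η, (ENNReal.ofReal (‖η‖ ^ 3) *
      ∑ j, ‖forcing c T b t η j‖ₑ) ^ 2 ≤ ENNReal.ofReal c⁻¹ * δ₂)
    (hs : 36864 * (ENNReal.ofReal (4 * π) * (Fintype.card (Fin 3) : ℝ≥0∞) ^ 2) ^ 2 *
        ((SNormLESNormFDerivOfEqConst ℂ (volume : Measure (EuclideanSpace ℝ (Fin 3))) 2 *
          ENNReal.ofReal (2 * π)) ^ (3 / 2 : ℝ)) ^ 2 * ENNReal.ofReal c⁻¹ *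
        (ENNReal.ofReal T * ENNReal.ofReal c⁻¹) ^ (1 / 2 : ℝ) * δ₁ ≤ 1) (ξ : EuclideanSpace ℝ (Fin 3)) :
    picardLimitForced c T a b 0 ξ = a ξ := by
  have hconst : ∀ n, picardIterForced c T a b n 0 ξ = a ξ := fun n => by
    cases n with
    | zero => simp [picardIterForced, clamp_zero hT, forcing_zero hT]
    | succ n => exact duhamelForced_zero hT ξ
  have h := tendsto_picardIterForced_picardLimitForced hc hT ha haw hbm hbt hbd hδ₁ hδ₂ hα₁ hα₂ hF₁ hG₁ hF₂ hG₂ hs 0 ξ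
  simp_rw [hconst] at h
  exact (tendsto_nhds_unique tendsto_const_nhds h).symm

/-- **Divergence-free forced limit**: `∑ₗ ξₗ picardLimitForced(t,ξ)ₗ = 0` if the datum and the
force coefficients are divergence free (induction along the iteration in the `L²` class —
`sum_mul_duhamel_of_tendsto` for the homogeneous part, `sum_mul_forcing` for the forcing term —
then the pointwise limit). [cite: Tao2011, Thm. 5.4 (ii) (arXiv Thm. 31), p. 6] -/
theorem sum_mul_picardLimitForced (hc : 0 < c) (hT : 0 ≤ T) (ha : AEStronglyMeasurable a volume)
    (haw : ∀ (k : ℕ) j, ∫⁻ η, (ENNReal.ofReal ((1 + ‖η‖) ^ k) * ‖a η j‖ₑ) ^ 2 < ⊤)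
    (hbm : Measurable (uncurry b)) (hbt : ∀ ξ, Continuous fun s => b s ξ)
    (hbd : ∀ K : ℕ, ∃ B : ℝ, ∀ s, HasDecay K B (b s))
    {δ₁ δ₂ : ℝ≥0∞} (hδ₁ : δ₁ < ⊤) (hδ₂ : δ₂ < ⊤)
    (hα₁ : ∫⁻ η, (ENNReal.ofReal ‖η‖ * ∑ j, ‖a η j‖ₑ) ^ 2 ≤ δ₁)
    (hα₂ : ∫⁻ η, (ENNReal.ofReal (‖η‖ ^ 2) * ∑ j, ‖a η j‖ₑ) ^ 2 ≤ δ₂)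
    (hF₁ : ∀ t ∈ Icc 0 T, ∫⁻ η, (ENNReal.ofReal ‖η‖ * ∑ j, ‖forcing c T b t η j‖ₑ) ^ 2 ≤ δ₁)
    (hG₁ : ∫⁻ t in Ioc 0 T, ∫⁻ η, (ENNReal.ofReal (‖η‖ ^ 2) *
      ∑ j, ‖forcing c T b t η j‖ₑ) ^ 2 ≤ ENNReal.ofReal c⁻¹ * δ₁)
    (hF₂ : ∀ t ∈ Icc 0 T, ∫⁻ η, (ENNReal.ofReal (‖η‖ ^ 2) * ∑ j, ‖forcing c T b t η j‖ₑ) ^ 2 ≤ δ₂)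
    (hG₂ : ∫⁻ t in Ioc 0 T, ∫⁻ η, (ENNReal.ofReal (‖η‖ ^ 3) *
      ∑ j, ‖forcing c T b t η j‖ₑ) ^ 2 ≤ ENNReal.ofReal c⁻¹ * δ₂)
    (hs : 36864 * (ENNReal.ofReal (4 * π) * (Fintype.card (Fin 3) : ℝ≥0∞) ^ 2) ^ 2 *
        ((SNormLESNormFDerivOfEqConst ℂ (volume : Measure (EuclideanSpace ℝ (Fin 3))) 2 *
          ENNReal.ofReal (2 * π)) ^ (3 / 2 : ℝ)) ^ 2 * ENNReal.ofReal c⁻¹ *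
        (ENNReal.ofReal T * ENNReal.ofReal c⁻¹) ^ (1 / 2 : ℝ) * δ₁ ≤ 1)
    (hdiv : ∀ ξ, ∑ l, ((ξ l : ℝ) : ℂ) * a ξ l = 0)
    (hbdiv : ∀ s ξ, ∑ l, ((ξ l : ℝ) : ℂ) * b s ξ l = 0) (t : ℝ) (ξ : EuclideanSpace ℝ (Fin 3)) :
    ∑ l, ((ξ l : ℝ) : ℂ) * picardLimitForced c T a b t ξ l = 0 := by
  have hiter : ∀ n, ∑ l, ((ξ l : ℝ) : ℂ) * picardIterForced c T a b n t ξ l = 0 := by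
    intro n
    induction n with
    | zero =>
      simp only [picardIterForced, Pi.add_apply, Pi.smul_apply, Complex.real_smul, mul_add,
        Finset.sum_add_distrib, sum_mul_forcing' hbt hbdiv t ξ, add_zero]
      calc ∑ l, ((ξ l : ℝ) : ℂ) * ((heat c ξ (clamp T t) : ℂ) * a ξ l)
          = (heat c ξ (clamp T t) : ℂ) * ∑ l, ((ξ l : ℝ) : ℂ) * a ξ l := by
            rw [Finset.mul_sum]; congr 1 with l; ring
        _ = 0 := by rw [hdiv, mul_zero]
    | succ n _ =>
      -- the `L²` package of `v_n = h - E_n`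
      set En : ℝ → EuclideanSpace ℝ (Fin 3) → Fin 3 → ℂ :=
        fun t ξ => heat c ξ (clamp T t) • a ξ - picardIterForced c T a b n t ξ with hEn
      obtain ⟨-, hEm, hEt, hEd⟩ := class_picardIterForced' hc.le hT ha haw hbm hbt hbd n
      have hm₀lt : Module.finrank ℝ (EuclideanSpace ℝ (Fin 3)) <
          2 * (Module.finrank ℝ (EuclideanSpace ℝ (Fin 3)) + 1) := finrank_lt_two_mul_succ
      have ha2 : ∀ j, ∫⁻ η, ‖a η j‖ₑ ^ 2 < ⊤ := fun j => by simpa using haw 0 j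
      obtain ⟨B₀, hB₀⟩ := hEd (Module.finrank ℝ (EuclideanSpace ℝ (Fin 3)) + 1)
      have hv2 : ∀ s j, MemLp (fun η => picardIterForced c T a b n s η j) 2 volume := fun s j => by
        have h := memLp_hsub_apply' c T a En hc.le ha ha2 hEm hm₀lt hB₀ s j
        simpa only [hEn, sub_sub_cancel] using h
      have hvc : ∀ j s₀, Tendsto (fun s => eLpNorm ((fun η => picardIterForced c T a b n s η j) -
          (fun η => picardIterForced c T a b n s₀ η j)) 2 volume) (𝓝 s₀) (𝓝 0) := fun j s₀ => by
        have h := tendsto_eLpNorm_hsub_apply' c T a En hc.le ha ha2 hEm hEt hm₀lt hB₀ j s₀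
        simpa only [hEn, sub_sub_cancel] using h
      show ∑ l, ((ξ l : ℝ) : ℂ) * duhamelForced c T a b (picardIterForced c T a b n) t ξ l = 0
      simp only [duhamelForced_eq, Pi.add_apply, mul_add, Finset.sum_add_distrib,
        sum_mul_duhamel_of_tendsto hv2 hvc hdiv t ξ, sum_mul_forcing' hbt hbdiv t ξ, add_zero]
  have h := tendsto_picardIterForced_picardLimitForced hc hT ha haw hbm hbt hbd hδ₁ hδ₂ hα₁ hα₂ hF₁ hG₁ hF₂ hG₂ hs t ξ
  have hcont : Continuous fun z : Fin 3 → ℂ => ∑ l, ((ξ l : ℝ) : ℂ) * z l := by fun_prop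
  have h2 := (hcont.tendsto _).comp h
  simp only [Function.comp_def, hiter] at h2
  exact (tendsto_nhds_unique tendsto_const_nhds h2).symm

/-- **Conjugation symmetry of the forced limit**:
`picardLimitForced(t,-ξ)ₗ = conj picardLimitForced(t,ξ)ₗ` if `a(-ξ) = conj a(ξ)` and
`b(s,-ξ) = conj b(s,ξ)` (induction along the iteration — `duhamel_conj_symm_of_tendsto`,
`forcing_conj_symm` — then the limit). [cite: Tao2011, Thm. 5.4 (ii) (arXiv Thm. 31)] -/
theorem picardLimitForced_conj_symm (hc : 0 < c) (hT : 0 ≤ T) (ha : AEStronglyMeasurable a volume)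
    (haw : ∀ (k : ℕ) j, ∫⁻ η, (ENNReal.ofReal ((1 + ‖η‖) ^ k) * ‖a η j‖ₑ) ^ 2 < ⊤)
    (hbm : Measurable (uncurry b)) (hbt : ∀ ξ, Continuous fun s => b s ξ)
    (hbd : ∀ K : ℕ, ∃ B : ℝ, ∀ s, HasDecay K B (b s))
    {δ₁ δ₂ : ℝ≥0∞} (hδ₁ : δ₁ < ⊤) (hδ₂ : δ₂ < ⊤)
    (hα₁ : ∫⁻ η, (ENNReal.ofReal ‖η‖ * ∑ j, ‖a η j‖ₑ) ^ 2 ≤ δ₁)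
    (hα₂ : ∫⁻ η, (ENNReal.ofReal (‖η‖ ^ 2) * ∑ j, ‖a η j‖ₑ) ^ 2 ≤ δ₂)
    (hF₁ : ∀ t ∈ Icc 0 T, ∫⁻ η, (ENNReal.ofReal ‖η‖ * ∑ j, ‖forcing c T b t η j‖ₑ) ^ 2 ≤ δ₁)
    (hG₁ : ∫⁻ t in Ioc 0 T, ∫⁻ η, (ENNReal.ofReal (‖η‖ ^ 2) *
      ∑ j, ‖forcing c T b t η j‖ₑ) ^ 2 ≤ ENNReal.ofReal c⁻¹ * δ₁)
    (hF₂ : ∀ t ∈ Icc 0 T, ∫⁻ η, (ENNReal.ofReal (‖η‖ ^ 2) * ∑ j, ‖forcing c T b t η j‖ₑ) ^ 2 ≤ δ₂)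
    (hG₂ : ∫⁻ t in Ioc 0 T, ∫⁻ η, (ENNReal.ofReal (‖η‖ ^ 3) *
      ∑ j, ‖forcing c T b t η j‖ₑ) ^ 2 ≤ ENNReal.ofReal c⁻¹ * δ₂)
    (hs : 36864 * (ENNReal.ofReal (4 * π) * (Fintype.card (Fin 3) : ℝ≥0∞) ^ 2) ^ 2 *
        ((SNormLESNormFDerivOfEqConst ℂ (volume : Measure (EuclideanSpace ℝ (Fin 3))) 2 *
          ENNReal.ofReal (2 * π)) ^ (3 / 2 : ℝ)) ^ 2 * ENNReal.ofReal c⁻¹ *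
        (ENNReal.ofReal T * ENNReal.ofReal c⁻¹) ^ (1 / 2 : ℝ) * δ₁ ≤ 1)
    (haconj : ∀ ξ l, a (-ξ) l = conj (a ξ l)) (hbconj : ∀ s ξ l, b s (-ξ) l = conj (b s ξ l))
    (t : ℝ) (ξ : EuclideanSpace ℝ (Fin 3)) (l : Fin 3) :
    picardLimitForced c T a b t (-ξ) l = conj (picardLimitForced c T a b t ξ l) := by
  have hiter : ∀ n s ζ j, picardIterForced c T a b n s (-ζ) j = conj (picardIterForced c T a b n s ζ j) := by
    intro n
    induction n with
    | zero =>
      intro s ζ j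
      simp [picardIterForced, heat_neg, haconj, Complex.conj_ofReal, forcing_conj_symm' hbt hbconj s ζ j]
    | succ n ih =>
      intro s ζ j
      set En : ℝ → EuclideanSpace ℝ (Fin 3) → Fin 3 → ℂ :=
        fun t ξ => heat c ξ (clamp T t) • a ξ - picardIterForced c T a b n t ξ with hEn
      obtain ⟨-, hEm, hEt, hEd⟩ := class_picardIterForced' hc.le hT ha haw hbm hbt hbd n
      have hm₀lt : Module.finrank ℝ (EuclideanSpace ℝ (Fin 3)) <
          2 * (Module.finrank ℝ (EuclideanSpace ℝ (Fin 3)) + 1) := finrank_lt_two_mul_succ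
      have ha2 : ∀ j, ∫⁻ η, ‖a η j‖ₑ ^ 2 < ⊤ := fun j => by simpa using haw 0 j
      obtain ⟨B₀, hB₀⟩ := hEd (Module.finrank ℝ (EuclideanSpace ℝ (Fin 3)) + 1)
      have hv2 : ∀ s j, MemLp (fun η => picardIterForced c T a b n s η j) 2 volume := fun s j => by
        have h := memLp_hsub_apply' c T a En hc.le ha ha2 hEm hm₀lt hB₀ s j
        simpa only [hEn, sub_sub_cancel] using h
      have hvc : ∀ j s₀, Tendsto (fun s => eLpNorm ((fun η => picardIterForced c T a b n s η j) -
          (fun η => picardIterForced c T a b n s₀ η j)) 2 volume) (𝓝 s₀) (𝓝 0) := fun j s₀ => by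
        have h := tendsto_eLpNorm_hsub_apply' c T a En hc.le ha ha2 hEm hEt hm₀lt hB₀ j s₀
        simpa only [hEn, sub_sub_cancel] using h
      show duhamelForced c T a b (picardIterForced c T a b n) s (-ζ) j =
        conj (duhamelForced c T a b (picardIterForced c T a b n) s ζ j)
      rw [duhamelForced_eq, duhamelForced_eq, Pi.add_apply, Pi.add_apply, map_add,
        duhamel_conj_symm_of_tendsto hv2 hvc haconj ih s ζ j, forcing_conj_symm' hbt hbconj s ζ j]
  have h := tendsto_picardIterForced_picardLimitForced hc hT ha haw hbm hbt hbd hδ₁ hδ₂ hα₁ hα₂ hF₁ hG₁ hF₂ hG₂ hs t ξ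
  have h' := tendsto_picardIterForced_picardLimitForced hc hT ha haw hbm hbt hbd hδ₁ hδ₂ hα₁ hα₂ hF₁ hG₁ hF₂ hG₂ hs t (-ξ)
  have h1 : Tendsto (fun n => picardIterForced c T a b n t (-ξ) l) atTop (𝓝 (picardLimitForced c T a b t (-ξ) l)) :=
    ((continuous_apply l).tendsto _).comp h'
  have h2 : Tendsto (fun n => conj (picardIterForced c T a b n t ξ l)) atTop (𝓝 (conj (picardLimitForced c T a b t ξ l))) :=
    (Complex.continuous_conj.tendsto _).comp (((continuous_apply l).tendsto _).comp h)
  simp only [hiter] at h1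
  exact tendsto_nhds_unique h1 h2


/-- Measurability of the time slices of the forced limit.
[cite: Tao2011, Thm. 5.4 (ii) (arXiv Thm. 31)] -/
theorem aestronglyMeasurable_picardLimitForced (hc : 0 < c) (hT : 0 ≤ T) (ha : AEStronglyMeasurable a volume)
    (haw : ∀ (k : ℕ) j, ∫⁻ η, (ENNReal.ofReal ((1 + ‖η‖) ^ k) * ‖a η j‖ₑ) ^ 2 < ⊤)
    (hbm : Measurable (uncurry b)) (hbt : ∀ ξ, Continuous fun s => b s ξ)
    (hbd : ∀ K : ℕ, ∃ B : ℝ, ∀ s, HasDecay K B (b s))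
    {δ₁ δ₂ : ℝ≥0∞} (hδ₁ : δ₁ < ⊤) (hδ₂ : δ₂ < ⊤)
    (hα₁ : ∫⁻ η, (ENNReal.ofReal ‖η‖ * ∑ j, ‖a η j‖ₑ) ^ 2 ≤ δ₁)
    (hα₂ : ∫⁻ η, (ENNReal.ofReal (‖η‖ ^ 2) * ∑ j, ‖a η j‖ₑ) ^ 2 ≤ δ₂)
    (hF₁ : ∀ t ∈ Icc 0 T, ∫⁻ η, (ENNReal.ofReal ‖η‖ * ∑ j, ‖forcing c T b t η j‖ₑ) ^ 2 ≤ δ₁)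
    (hG₁ : ∫⁻ t in Ioc 0 T, ∫⁻ η, (ENNReal.ofReal (‖η‖ ^ 2) *
      ∑ j, ‖forcing c T b t η j‖ₑ) ^ 2 ≤ ENNReal.ofReal c⁻¹ * δ₁)
    (hF₂ : ∀ t ∈ Icc 0 T, ∫⁻ η, (ENNReal.ofReal (‖η‖ ^ 2) * ∑ j, ‖forcing c T b t η j‖ₑ) ^ 2 ≤ δ₂)
    (hG₂ : ∫⁻ t in Ioc 0 T, ∫⁻ η, (ENNReal.ofReal (‖η‖ ^ 3) *
      ∑ j, ‖forcing c T b t η j‖ₑ) ^ 2 ≤ ENNReal.ofReal c⁻¹ * δ₂)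
    (hs : 36864 * (ENNReal.ofReal (4 * π) * (Fintype.card (Fin 3) : ℝ≥0∞) ^ 2) ^ 2 *
        ((SNormLESNormFDerivOfEqConst ℂ (volume : Measure (EuclideanSpace ℝ (Fin 3))) 2 *
          ENNReal.ofReal (2 * π)) ^ (3 / 2 : ℝ)) ^ 2 * ENNReal.ofReal c⁻¹ *
        (ENNReal.ofReal T * ENNReal.ofReal c⁻¹) ^ (1 / 2 : ℝ) * δ₁ ≤ 1) (t : ℝ) :
    AEStronglyMeasurable (picardLimitForced c T a b t) volume := by
  have hEm := measurable_hsub_picardLimitForced hc hT ha haw hbm hbt hbd hδ₁ hδ₂ hα₁ hα₂ hF₁ hG₁ hF₂ hG₂ hs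
  have h : picardLimitForced c T a b t = fun ξ => heat c ξ (clamp T t) • a ξ -
      (heat c ξ (clamp T t) • a ξ - picardLimitForced c T a b t ξ) := by
    funext ξ; rw [sub_sub_cancel]
  rw [h]
  exact aestronglyMeasurable_hsub_slice' c T a _ ha hEm t

/-- **The forced limit solves the forced mild (Duhamel) equation**:
`picardLimitForced = duhamelForced c T a b picardLimitForced`, i.e.
`v(t) = heat(t) • a + ∫₀ᵗ heat(t-s) • b(s) ds − ∫₀ᵗ heat(t-s) • N(v(s), v(s)) ds` at every frequency
— Tao's Duhamel formula (7) WITH force — (pass to the limit in `w_{n+1} = Φ_b(w_n)`: the forcing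
term is constant along the iteration and the Duhamel integrals converge by the weighted difference
step `exp_weight_enorm_duhamelIntegral_hsub_sub_le` applied to `E_n` and `E = h − v`, whose
difference decays like `2^{-n}(1+‖η‖)^{-2}`).
[cite: Tao2011, Thm. 5.4 (ii) (arXiv Thm. 31), Duhamel formula (7); proof of Thm. 5.1 (arXiv p. 16)] -/
theorem picardLimitForced_eq_duhamelForced (hc : 0 < c) (hT : 0 ≤ T) (ha : AEStronglyMeasurable a volume)
    (haw : ∀ (k : ℕ) j, ∫⁻ η, (ENNReal.ofReal ((1 + ‖η‖) ^ k) * ‖a η j‖ₑ) ^ 2 < ⊤)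
    (hbm : Measurable (uncurry b)) (hbt : ∀ ξ, Continuous fun s => b s ξ)
    (hbd : ∀ K : ℕ, ∃ B : ℝ, ∀ s, HasDecay K B (b s))
    {δ₁ δ₂ : ℝ≥0∞} (hδ₁ : δ₁ < ⊤) (hδ₂ : δ₂ < ⊤)
    (hα₁ : ∫⁻ η, (ENNReal.ofReal ‖η‖ * ∑ j, ‖a η j‖ₑ) ^ 2 ≤ δ₁)
    (hα₂ : ∫⁻ η, (ENNReal.ofReal (‖η‖ ^ 2) * ∑ j, ‖a η j‖ₑ) ^ 2 ≤ δ₂)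
    (hF₁ : ∀ t ∈ Icc 0 T, ∫⁻ η, (ENNReal.ofReal ‖η‖ * ∑ j, ‖forcing c T b t η j‖ₑ) ^ 2 ≤ δ₁)
    (hG₁ : ∫⁻ t in Ioc 0 T, ∫⁻ η, (ENNReal.ofReal (‖η‖ ^ 2) *
      ∑ j, ‖forcing c T b t η j‖ₑ) ^ 2 ≤ ENNReal.ofReal c⁻¹ * δ₁)
    (hF₂ : ∀ t ∈ Icc 0 T, ∫⁻ η, (ENNReal.ofReal (‖η‖ ^ 2) * ∑ j, ‖forcing c T b t η j‖ₑ) ^ 2 ≤ δ₂)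
    (hG₂ : ∫⁻ t in Ioc 0 T, ∫⁻ η, (ENNReal.ofReal (‖η‖ ^ 3) *
      ∑ j, ‖forcing c T b t η j‖ₑ) ^ 2 ≤ ENNReal.ofReal c⁻¹ * δ₂)
    (hs : 36864 * (ENNReal.ofReal (4 * π) * (Fintype.card (Fin 3) : ℝ≥0∞) ^ 2) ^ 2 *
        ((SNormLESNormFDerivOfEqConst ℂ (volume : Measure (EuclideanSpace ℝ (Fin 3))) 2 *
          ENNReal.ofReal (2 * π)) ^ (3 / 2 : ℝ)) ^ 2 * ENNReal.ofReal c⁻¹ *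
        (ENNReal.ofReal T * ENNReal.ofReal c⁻¹) ^ (1 / 2 : ℝ) * δ₁ ≤ 1) (t : ℝ) (ξ : EuclideanSpace ℝ (Fin 3)) :
    picardLimitForced c T a b t ξ = duhamelForced c T a b (picardLimitForced c T a b) t ξ := by
  -- reduce to `t ∈ [0, T]`
  suffices hIcc : ∀ t ∈ Icc 0 T, ∀ ξ,
      picardLimitForced c T a b t ξ = duhamelForced c T a b (picardLimitForced c T a b) t ξ by
    have h := hIcc (clamp T t) (clamp_mem_Icc hT t) ξ
    rwa [picardLimitForced_clamp hT t, duhamelForced_clamp hT t ξ] at h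
  intro t ht ξ
  -- the Duhamel part of the limit and its class
  set E : ℝ → EuclideanSpace ℝ (Fin 3) → Fin 3 → ℂ :=
    fun t ξ => heat c ξ (clamp T t) • a ξ - picardLimitForced c T a b t ξ with hE
  have hEm : Measurable (uncurry E) :=
    measurable_hsub_picardLimitForced hc hT ha haw hbm hbt hbd hδ₁ hδ₂ hα₁ hα₂ hF₁ hG₁ hF₂ hG₂ hs
  have hEt : ∀ η, Continuous fun t => E t η :=
    continuous_hsub_picardLimitForced_time hc hT ha haw hbm hbt hbd hδ₁ hδ₂ hα₁ hα₂ hF₁ hG₁ hF₂ hG₂ hs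
  have hEd : ∀ K : ℕ, ∃ B : ℝ, ∀ t, HasDecay K B (E t) := fun K =>
    exists_hasDecay_hsub_picardLimitForced hc hT ha haw hbm hbt hbd hδ₁ hδ₂ hα₁ hα₂ hF₁ hG₁ hF₂ hG₂ hs K
  have hv : (fun s η => heat c η (clamp T s) • a η - E s η) = picardLimitForced c T a b := by
    funext s η; simp [hE]
  -- the two limits of `v_{n+1}(t, ξ)`
  have hlim := tendsto_picardIterForced_picardLimitForced hc hT ha haw hbm hbt hbd hδ₁ hδ₂ hα₁ hα₂ hF₁ hG₁ hF₂ hG₂ hs t ξ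
  have hlim1 : Tendsto (fun n => picardIterForced c T a b (n + 1) t ξ) atTop (𝓝 (picardLimitForced c T a b t ξ)) :=
    hlim.comp (tendsto_add_atTop_nat 1)
  suffices hD : Tendsto (fun n => duhamelIntegral c T (picardIterForced c T a b n) t ξ) atTop
      (𝓝 (duhamelIntegral c T (picardLimitForced c T a b) t ξ)) by
    have h2 : Tendsto (fun n => picardIterForced c T a b (n + 1) t ξ) atTop
        (𝓝 (heat c ξ (clamp T t) • a ξ + forcing c T b t ξ -
          duhamelIntegral c T (picardLimitForced c T a b) t ξ)) := by
      have h3 : Tendsto (fun n => heat c ξ (clamp T t) • a ξ + forcing c T b t ξ -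
          duhamelIntegral c T (picardIterForced c T a b n) t ξ)
          atTop (𝓝 (heat c ξ (clamp T t) • a ξ + forcing c T b t ξ -
            duhamelIntegral c T (picardLimitForced c T a b) t ξ)) :=
        tendsto_const_nhds.sub hD
      refine h3.congr fun n => ?_
      rw [picardIterForced_succ, duhamelForced_eq_sub]
    rw [duhamelForced_eq_sub]
    exact tendsto_nhds_unique hlim1 h2
  -- uniform inputs: decay of orders 2 and 4 of the `E_n` and of `E`, and the rate of order 2
  obtain ⟨B₂, hB₂⟩ := exists_uniform_hasDecay_picardIterForced' hc hT ha haw hbm hbt hbd hδ₁ hδ₂ hα₁ hα₂ hF₁ hG₁ hF₂ hG₂ hs 2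
  obtain ⟨B₄, hB₄⟩ := exists_uniform_hasDecay_picardIterForced' hc hT ha haw hbm hbt hbd hδ₁ hδ₂ hα₁ hα₂ hF₁ hG₁ hF₂ hG₂ hs 4
  obtain ⟨B₂', hB₂'⟩ := hEd 2
  obtain ⟨B₄', hB₄'⟩ := hEd 4
  obtain ⟨Br, hBr⟩ := exists_norm_picardIterForced_sub_picardLimitForced_le hc hT ha haw hbm hbt hbd hδ₁ hδ₂ hα₁ hα₂ hF₁ hG₁ hF₂ hG₂ hs 2
  have hBr0 : 0 ≤ Br := by
    have h := hBr 0 t ξ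
    rw [pow_zero, mul_one] at h
    exact le_trans (by positivity) h
  -- the envelopes
  set Amaj : EuclideanSpace ℝ (Fin 3) → ℝ≥0∞ := fun η => ∑ j, ‖a η j‖ₑ with hAmaj
  have hAm : AEMeasurable Amaj volume := aemeasurable_majorant ha
  set w2inv : EuclideanSpace ℝ (Fin 3) → ℝ≥0∞ := fun η => (ENNReal.ofReal ((1 + ‖η‖) ^ 2))⁻¹ with hw2inv
  set w4inv : EuclideanSpace ℝ (Fin 3) → ℝ≥0∞ := fun η => (ENNReal.ofReal ((1 + ‖η‖) ^ 4))⁻¹ with hw4inv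
  have hw2m : Measurable w2inv := (measurable_ofReal_weight 2).inv
  have hw4m : Measurable w4inv := (measurable_ofReal_weight 4).inv
  set Ψ : EuclideanSpace ℝ (Fin 3) → ℝ≥0∞ := fun η => ENNReal.ofReal B₄ * w4inv η with hΨ
  set Ψ' : EuclideanSpace ℝ (Fin 3) → ℝ≥0∞ := fun η => ENNReal.ofReal B₄' * w4inv η with hΨ'
  set β : ℝ≥0∞ := ENNReal.ofReal B₂ + ENNReal.ofReal B₂' with hβ
  set Qn : ℕ → EuclideanSpace ℝ (Fin 3) → ℝ≥0∞ := fun n η => ENNReal.ofReal (Br * (1 / 2) ^ n) * w2inv η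
    with hQn
  have hwdec : ∀ {F : EuclideanSpace ℝ (Fin 3) → Fin 3 → ℂ} {K : ℕ} {B : ℝ}, HasDecay K B F →
      ∀ η, ENNReal.ofReal ((1 + ‖η‖) ^ K) * ‖F η‖ₑ ≤ ENNReal.ofReal B := by
    intro F K B hF η
    have hw0 : ENNReal.ofReal ((1 + ‖η‖) ^ K) ≠ 0 :=
      (lt_of_lt_of_le zero_lt_one (one_le_ofReal_weight K η)).ne'
    calc ENNReal.ofReal ((1 + ‖η‖) ^ K) * ‖F η‖ₑ
        ≤ ENNReal.ofReal ((1 + ‖η‖) ^ K) * (ENNReal.ofReal B * (ENNReal.ofReal ((1 + ‖η‖) ^ K))⁻¹) :=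
          mul_le_mul' le_rfl (hF.enorm_le η)
      _ = ENNReal.ofReal B := by
          rw [mul_comm (ENNReal.ofReal B), ← mul_assoc, ENNReal.mul_inv_cancel hw0 ENNReal.ofReal_ne_top,
            one_mul]
  -- the bound of the Duhamel differences
  set C : ℝ≥0∞ := ENNReal.ofReal (4 * π) * (Fintype.card (Fin 3) : ℝ≥0∞) ^ 2 with hC
  set μ : ℝ≥0∞ := ENNReal.ofReal (1 / (2 * Real.sqrt (c * 1))) * (C * 2 ^ 0) with hμ
  set G₀ : EuclideanSpace ℝ (Fin 3) → ℝ≥0∞ := fun η => Amaj η + 3 * Ψ η with hG₀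
  set G₀' : EuclideanSpace ℝ (Fin 3) → ℝ≥0∞ := fun η => Amaj η + 3 * Ψ' η with hG₀'
  set GK : EuclideanSpace ℝ (Fin 3) → ℝ≥0∞ := fun η => ENNReal.ofReal ((1 + ‖η‖) ^ 0) * Amaj η +
    3 * (β * (ENNReal.ofReal ((1 + ‖η‖) ^ 2))⁻¹) with hGK
  have hG₀m : AEMeasurable G₀ volume := hAm.add ((hw4m.const_mul _).const_mul _).aemeasurable
  have hG₀'m : AEMeasurable G₀' volume := hAm.add ((hw4m.const_mul _).const_mul _).aemeasurable
  have hGKm : AEMeasurable GK volume :=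
    ((measurable_ofReal_weight 0).aemeasurable.mul hAm).add
      (((measurable_ofReal_weight 2).inv.const_mul _).const_mul _).aemeasurable
  set Mb : ℝ≥0∞ := μ * (3 * (2 * (∫⁻ η, GK η ^ 2) ^ (1 / 2 : ℝ) + (∫⁻ η, G₀ η ^ 2) ^ (1 / 2 : ℝ) +
    (∫⁻ η, G₀' η ^ 2) ^ (1 / 2 : ℝ))) with hMb
  -- finiteness of `Mb`
  have hW2 : ∫⁻ η, w2inv η ^ 2 < ⊤ := lintegral_weight_inv_sq_lt_top finrank_three_lt_four
  have hW4 : ∫⁻ η, w4inv η ^ 2 < ⊤ := by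
    refine lt_of_le_of_lt (lintegral_mono fun η => pow_le_pow_left' ?_ 2) hW2
    exact ENNReal.inv_le_inv.2 (ENNReal.ofReal_le_ofReal
      (pow_le_pow_right₀ (by linarith [norm_nonneg η]) (by norm_num)))
  have hsq : ∀ x y : ℝ≥0∞, (x + y) ^ 2 ≤ 2 * x ^ 2 + 2 * y ^ 2 := fun x y => by
    have h := ENNReal.rpow_add_le_mul_rpow_add_rpow x y (p := 2) (by norm_num)
    norm_num at h
    rw [← mul_add]
    exact_mod_cast h
  have hα0 : ∫⁻ η, Amaj η ^ 2 < ⊤ := by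
    have h := lintegral_weight_majorant_sq_lt_top ha 0 (haw 0)
    simpa using h
  have hL2 : ∀ {F G : EuclideanSpace ℝ (Fin 3) → ℝ≥0∞}, AEMeasurable F volume →
      ∫⁻ η, F η ^ 2 < ⊤ → ∫⁻ η, G η ^ 2 < ⊤ → ∫⁻ η, (F η + G η) ^ 2 < ⊤ := by
    intro F G hFm hF hG
    refine lt_of_le_of_lt (lintegral_mono fun η => hsq _ _) ?_
    rw [lintegral_add_left' ((hFm.pow_const 2).const_mul _), lintegral_const_mul' _ _ (by norm_num),
      lintegral_const_mul' _ _ (by norm_num)]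
    exact ENNReal.add_lt_top.2 ⟨ENNReal.mul_lt_top (by norm_num) hF, ENNReal.mul_lt_top (by norm_num) hG⟩
  have hcw : ∀ (x : ℝ≥0∞) {W : EuclideanSpace ℝ (Fin 3) → ℝ≥0∞}, x ≠ ⊤ → Measurable W →
      ∫⁻ η, W η ^ 2 < ⊤ → ∫⁻ η, (x * W η) ^ 2 < ⊤ := by
    intro x W hx hWm hW
    simp_rw [mul_pow]
    rw [lintegral_const_mul' _ _ (ENNReal.pow_ne_top hx)]
    exact ENNReal.mul_lt_top (ENNReal.pow_lt_top hx.lt_top) hW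
  have hG₀2 : ∫⁻ η, G₀ η ^ 2 < ⊤ := hL2 hAm hα0 (by
    have h := hcw (3 * ENNReal.ofReal B₄) (ENNReal.mul_ne_top (by norm_num) ENNReal.ofReal_ne_top) hw4m hW4
    refine lt_of_le_of_lt (le_of_eq (lintegral_congr fun η => ?_)) h
    simp only [hΨ]; ring)
  have hG₀'2 : ∫⁻ η, G₀' η ^ 2 < ⊤ := hL2 hAm hα0 (by
    have h := hcw (3 * ENNReal.ofReal B₄') (ENNReal.mul_ne_top (by norm_num) ENNReal.ofReal_ne_top) hw4m hW4
    refine lt_of_le_of_lt (le_of_eq (lintegral_congr fun η => ?_)) h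
    simp only [hΨ']; ring)
  have hbtop : β ≠ ⊤ := ENNReal.add_ne_top.2 ⟨ENNReal.ofReal_ne_top, ENNReal.ofReal_ne_top⟩
  have hGK2 : ∫⁻ η, GK η ^ 2 < ⊤ := by
    refine hL2 ((measurable_ofReal_weight 0).aemeasurable.mul hAm) ?_ ?_
    · refine lt_of_le_of_lt (le_of_eq (lintegral_congr fun η => ?_)) hα0
      simp
    · have h := hcw (3 * β) (ENNReal.mul_ne_top (by norm_num) hbtop) hw2m hW2
      refine lt_of_le_of_lt (le_of_eq (lintegral_congr fun η => ?_)) h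
      simp only [hw2inv]; ring
  have hμtop : μ < ⊤ := ENNReal.mul_lt_top ENNReal.ofReal_lt_top
    (ENNReal.mul_lt_top (ENNReal.mul_lt_top ENNReal.ofReal_lt_top (by simp)) (by simp))
  have hrt : ∀ {x : ℝ≥0∞}, x < ⊤ → x ^ (1 / 2 : ℝ) < ⊤ := fun h =>
    ENNReal.rpow_lt_top_of_nonneg (by norm_num) h.ne
  have hMbtop : Mb < ⊤ := ENNReal.mul_lt_top hμtop (ENNReal.mul_lt_top (by norm_num)
    (ENNReal.add_lt_top.2 ⟨ENNReal.add_lt_top.2 ⟨ENNReal.mul_lt_top (by norm_num) (hrt hGK2), hrt hG₀2⟩,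
      hrt hG₀'2⟩))
  -- the `L²` norm of `Q_n`
  have hQn2 : ∀ n, (∫⁻ η, Qn n η ^ 2) ^ (1 / 2 : ℝ) =
      ENNReal.ofReal (Br * (1 / 2) ^ n) * (∫⁻ η, w2inv η ^ 2) ^ (1 / 2 : ℝ) := by
    intro n
    simp only [hQn]
    simp_rw [mul_pow]
    rw [lintegral_const_mul' _ _ (ENNReal.pow_ne_top ENNReal.ofReal_ne_top),
      ENNReal.mul_rpow_of_nonneg _ _ (by norm_num), ← ENNReal.rpow_natCast, ← ENNReal.rpow_mul]
    norm_num
  -- the key estimate for every `n`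
  have hkey : ∀ n, ‖duhamelIntegral c T (picardIterForced c T a b n) t ξ -
      duhamelIntegral c T (picardLimitForced c T a b) t ξ‖ₑ ≤
      ENNReal.ofReal (Real.exp t) * (Mb * (ENNReal.ofReal (Br * (1 / 2) ^ n) *
        (∫⁻ η, w2inv η ^ 2) ^ (1 / 2 : ℝ))) := by
    intro n
    set En : ℝ → EuclideanSpace ℝ (Fin 3) → Fin 3 → ℂ :=
      fun t ξ => heat c ξ (clamp T t) • a ξ - picardIterForced c T a b n t ξ with hEn
    have hvn : (fun s η => heat c η (clamp T s) • a η - En s η) = picardIterForced c T a b n := by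
      funext s η; simp [hEn]
    obtain ⟨-, hEnm, hEnt, hEnd⟩ := class_picardIterForced' hc.le hT ha haw hbm hbt hbd n
    have hΨ₁ : ∀ s ∈ Icc 0 T, ∀ η, ‖En s η‖ₑ ≤ Ψ η := by
      intro s _ η
      have h := (hB₄ n s).enorm_le η
      exact h
    have hΨ₂ : ∀ s ∈ Icc 0 T, ∀ η, ‖E s η‖ₑ ≤ Ψ' η := by
      intro s _ η
      exact (hB₄' s).enorm_le η
    have hb₁ : ∀ s ∈ Icc 0 T, ∀ η, ENNReal.ofReal ((1 + ‖η‖) ^ (0 + 2)) * ‖En s η‖ₑ ≤ β :=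
      fun s _ η => (hwdec (hB₂ n s) η).trans le_self_add
    have hb₂ : ∀ s ∈ Icc 0 T, ∀ η, ENNReal.ofReal ((1 + ‖η‖) ^ (0 + 2)) * ‖E s η‖ₑ ≤ β :=
      fun s _ η => (hwdec (hB₂' s) η).trans le_add_self
    have hQ : ∀ s ∈ Icc 0 T, ∀ η, ENNReal.ofReal (Real.exp (-1 * s) * (1 + ‖η‖) ^ 0) *
        ‖En s η - E s η‖ₑ ≤ Qn n η := by
      intro s hs η
      have hdiff : En s η - E s η = picardLimitForced c T a b s η - picardIterForced c T a b n s η := by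
        simp only [hEn, hE, sub_sub_sub_cancel_left]
      have hrate : ENNReal.ofReal ((1 + ‖η‖) ^ 2) * ‖picardLimitForced c T a b s η - picardIterForced c T a b n s η‖ₑ ≤
          ENNReal.ofReal (Br * (1 / 2) ^ n) := by
        rw [enorm_sub_rev, ← ofReal_norm, ← ENNReal.ofReal_mul (by positivity)]
        exact ENNReal.ofReal_le_ofReal (hBr n s η)
      have he : ENNReal.ofReal (Real.exp (-1 * s) * (1 + ‖η‖) ^ 0) ≤ 1 := by
        rw [pow_zero, mul_one, ← ENNReal.ofReal_one]
        exact ENNReal.ofReal_le_ofReal (Real.exp_le_one_iff.2 (by nlinarith [hs.1]))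
      have hw0 : ENNReal.ofReal ((1 + ‖η‖) ^ 2) ≠ 0 :=
        (lt_of_lt_of_le zero_lt_one (one_le_ofReal_weight 2 η)).ne'
      rw [hdiff]
      calc ENNReal.ofReal (Real.exp (-1 * s) * (1 + ‖η‖) ^ 0) * ‖picardLimitForced c T a b s η - picardIterForced c T a b n s η‖ₑ
          ≤ 1 * ‖picardLimitForced c T a b s η - picardIterForced c T a b n s η‖ₑ := mul_le_mul' he le_rfl
        _ = w2inv η * (ENNReal.ofReal ((1 + ‖η‖) ^ 2) * ‖picardLimitForced c T a b s η - picardIterForced c T a b n s η‖ₑ) := by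
            rw [one_mul, ← mul_assoc, hw2inv, ENNReal.inv_mul_cancel hw0 ENNReal.ofReal_ne_top, one_mul]
        _ ≤ w2inv η * ENNReal.ofReal (Br * (1 / 2) ^ n) := mul_le_mul' le_rfl hrate
        _ = Qn n η := by rw [hQn, mul_comm]
    have hmain := exp_weight_enorm_duhamelIntegral_hsub_sub_le' (T := T) hc ha haw hEnm hEnt hEnd hEm hEt hEd 0
      one_pos hΨ₁ hΨ₂ hb₁ hb₂ hQ ht ξ
    rw [hvn, hv] at hmain
    have hQm : AEMeasurable (Qn n) volume := (hw2m.const_mul _).aemeasurable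
    have hbound : ENNReal.ofReal (Real.exp (-1 * t) * (1 + ‖ξ‖) ^ 0) *
        ‖duhamelIntegral c T (picardIterForced c T a b n) t ξ - duhamelIntegral c T (picardLimitForced c T a b) t ξ‖ₑ ≤
        Mb * (∫⁻ η, Qn n η ^ 2) ^ (1 / 2 : ℝ) :=
      calc _ ≤ _ := hmain
        _ = μ * (3 * (((fun η => (ENNReal.ofReal ((1 + ‖η‖) ^ 0))⁻¹ * Qn n η) ⋆ₗ GK) ξ + (Qn n ⋆ₗ G₀) ξ +
            (G₀' ⋆ₗ Qn n) ξ + (GK ⋆ₗ (fun η => (ENNReal.ofReal ((1 + ‖η‖) ^ 0))⁻¹ * Qn n η)) ξ)) := by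
            simp only [hμ, hC, hGK, hG₀, hG₀', hAmaj]
            ring
        _ ≤ _ := diff_majorant_le hQm hG₀m hG₀'m hGKm 0 μ ξ
        _ = Mb * (∫⁻ η, Qn n η ^ 2) ^ (1 / 2 : ℝ) := by rw [hMb]; ring
    rw [hQn2 n] at hbound
    -- remove the exponential weight
    have hexp : (1 : ℝ≥0∞) = ENNReal.ofReal (Real.exp t) * ENNReal.ofReal (Real.exp (-1 * t) * (1 + ‖ξ‖) ^ 0) := by
      rw [pow_zero, mul_one, ← ENNReal.ofReal_mul (Real.exp_pos _).le, ← Real.exp_add,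
        show t + -1 * t = 0 by ring, Real.exp_zero, ENNReal.ofReal_one]
    calc ‖duhamelIntegral c T (picardIterForced c T a b n) t ξ - duhamelIntegral c T (picardLimitForced c T a b) t ξ‖ₑ
        = ENNReal.ofReal (Real.exp t) * (ENNReal.ofReal (Real.exp (-1 * t) * (1 + ‖ξ‖) ^ 0) *
            ‖duhamelIntegral c T (picardIterForced c T a b n) t ξ - duhamelIntegral c T (picardLimitForced c T a b) t ξ‖ₑ) := by
          rw [← mul_assoc, ← hexp, one_mul]
      _ ≤ ENNReal.ofReal (Real.exp t) * (Mb * (ENNReal.ofReal (Br * (1 / 2) ^ n) *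
          (∫⁻ η, w2inv η ^ 2) ^ (1 / 2 : ℝ))) := mul_le_mul' le_rfl hbound
  -- the right-hand side tends to zero
  have hzero : Tendsto (fun n : ℕ => ENNReal.ofReal (Real.exp t) * (Mb * (ENNReal.ofReal (Br * (1 / 2) ^ n) *
      (∫⁻ η, w2inv η ^ 2) ^ (1 / 2 : ℝ)))) atTop (𝓝 0) := by
    have h1 : Tendsto (fun n : ℕ => ENNReal.ofReal (Br * (1 / 2) ^ n)) atTop (𝓝 0) := by
      have h : Tendsto (fun n : ℕ => Br * (1 / 2 : ℝ) ^ n) atTop (𝓝 (Br * 0)) :=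
        (tendsto_pow_atTop_nhds_zero_of_lt_one (by norm_num) (by norm_num)).const_mul _
      rw [mul_zero] at h
      have h2 := (ENNReal.continuous_ofReal.tendsto 0).comp h
      rwa [Function.comp_def, ENNReal.ofReal_zero] at h2
    have h2 : Tendsto (fun n : ℕ => ENNReal.ofReal (Br * (1 / 2) ^ n) * (∫⁻ η, w2inv η ^ 2) ^ (1 / 2 : ℝ))
        atTop (𝓝 0) := by
      have h := ENNReal.Tendsto.mul_const h1 (Or.inr (hrt hW2).ne)
      rwa [zero_mul] at h
    have h3 : Tendsto (fun n : ℕ => Mb * (ENNReal.ofReal (Br * (1 / 2) ^ n) * (∫⁻ η, w2inv η ^ 2) ^ (1 / 2 : ℝ)))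
        atTop (𝓝 0) := by
      have h := ENNReal.Tendsto.const_mul h2 (Or.inr hMbtop.ne)
      rwa [mul_zero] at h
    have h4 := ENNReal.Tendsto.const_mul h3 (Or.inr (ENNReal.ofReal_ne_top (r := Real.exp t)))
    rwa [mul_zero] at h4
  rw [tendsto_iff_edist_tendsto_0]
  refine tendsto_of_tendsto_of_tendsto_of_le_of_le tendsto_const_nhds hzero (fun n => zero_le) fun n => ?_
  rw [edist_eq_enorm_sub]
  exact hkey n

end Limit

end Literature.Analysis.FluidPDE.FourierNS

end
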